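import Literature.AlgebraicGeometry.Resolution.SingularLocusClosure
import Literature.AlgebraicGeometry.Resolution.SandwichedGluingLocal
import Literature.AlgebraicGeometry.Resolution.ProperModelsPatching
import Literature.AlgebraicGeometry.Resolution.AlterationsResolution
import Literature.AlgebraicGeometry.Resolution.CanonicalResolutionProofs
import Literature.AlgebraicGeometry.Resolution.RegularLocusDense
import HarnessLib

/-!
# Local RegLe-ification of a morphism of proper models from strong resolution of the
# sandwiched piece

Topic: `Literature/AlgebraicGeometry/Resolution`. The geometric heart of Zariski's two-model
patching for PROPER models (Zariski 1944; Piltant 2013, proof of Prop. 5.1, Steps 4–5), in the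
one-morphism form of `ProperModelsPatching.lean`: for a morphism `φ : M → Y` of proper models of
`K/k` (`char k = p`), put `U := Reg Y` (open: `k`-schemes of finite type), `V := φ⁻¹(U)`; the
sandwiched piece `V → U` is proper and birational over the regular `U`, so
`SandwichedStrongResolution p` resolves it by a `π : Yv → V` which is an isomorphism over
`W = Reg V`; gluing `Yv` to `M ∖ closure (Sing V)` along `W` (`exists_glue_of_openGluing`,
`SandwichedGluingLocal.lean`, from the named fact `OpenGluing`) produces the data of
`ProperModel.LocalRegLeification p`.

* `exists_localRegLeification_data` — pure scheme theory: from an integral `X` with `Reg X`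
  open, an open `V ⊆ X`, an integral regular `Yv` and a proper `π : Yv → V` which is an
  isomorphism over the open `W = Reg V`, an open `O ⊇ Reg X ∪ V` and a proper birational
  `ρ : N → O`, `N` integral, regular over `Reg X` and over `V`.
* `ProperModel.localRegLeification_of_sandwiched` —
  `OpenGluing → SandwichedStrongResolution p → ProperModel.LocalRegLeification p`.

## References

* O. Zariski, *Reduction of the singularities of algebraic three dimensional varieties*,
  Ann. of Math. 45 (1944), Fundamental Theorem p. 539 (via Piltant).
* O. Piltant, *An axiomatic version of Zariski's patching theorem*, RACSAM 107 (2013) 91–121,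
  proof of Prop. 5.1, Steps 4–5. [Piltant2013]
* The Stacks Project, Tag 01LH. [StacksProject]
-/

noncomputable section

open CategoryTheory AlgebraicGeometry TopologicalSpace Topology
open Literature.AlgebraicGeometry.Morphisms

namespace Literature.AlgebraicGeometry.Resolution

universe u

/-- **Gluing a strong resolution of an open piece** (Piltant 2013, proof of Prop. 5.1, Step 5,
as pure scheme theory): let `X` be integral with `Reg X` open, `V ⊆ X` open, `Yv` integral and
regular, `π : Yv → V` proper and an isomorphism over the open `W` of `V` whose points are
`Reg V`. With `C := closure (Sing V)` (so `C ∩ V = Sing V`, `C ⊆ Sing X`) and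
`O := V ∪ (X ∖ C) ⊇ Reg X ∪ V`, gluing `Yv` to `X ∖ C` along `W` (`OpenGluing`) gives a proper
birational `ρ : N → O` with `N` integral whose points over `Reg X` and over `V` are regular.
[cite: Piltant2013, proof of Prop. 5.1, Step 5] -/
theorem exists_localRegLeification_data (hOG : OpenGluing.{u}) {X : Scheme.{u}} [IsIntegral X]
    (hReg : IsOpen (Scheme.regularLocus X)) (V : X.Opens) {Yv : Scheme.{u}} [IsIntegral Yv]
    (π : Yv ⟶ V) [IsProper π] (hY : Scheme.IsRegular Yv) (W : (V : Scheme.{u}).Opens)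
    (hW : (W : Set V) = Scheme.regularLocus V) [IsIso (π ∣_ W)] :
    ∃ (O : X.Opens) (N : Scheme.{u}) (ρ : N ⟶ ↑O), IsIntegral N ∧ IsProper ρ ∧
      IsBirational ρ ∧ Scheme.regularLocus X ⊆ O ∧ V ≤ O ∧
      (∀ n : N, IsRegularLocalRing (X.presheaf.stalk (ρ n).1) →
        IsRegularLocalRing (N.presheaf.stalk n)) ∧
      (∀ n : N, (ρ n).1 ∈ V → IsRegularLocalRing (N.presheaf.stalk n)) := by
  -- `V` receives the non-empty `Yv`, so it is a non-empty open of `X`: integral, `Reg V ≠ ∅`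
  obtain ⟨y₀⟩ := (inferInstance : Nonempty Yv)
  haveI : Nonempty (V : Scheme.{u}) := ⟨π y₀⟩
  haveI : IsIntegral (V : Scheme.{u}) := isIntegral_of_isOpenImmersion V.ι
  have hWne : (W : Set V).Nonempty := by
    rw [hW]
    exact (Scheme.dense_regularLocus (V : Scheme.{u})).nonempty
  -- `Wc := X ∖ closure (Sing V)`: `V ∩ Wc = W` and `Reg X ⊆ Wc`
  let Wc : X.Opens := ⟨(closure (V.ι '' (W : Set V)ᶜ))ᶜ, isClosed_closure.isOpen_compl⟩
  have hWc : V.ι ⁻¹ᵁ Wc = W := Scheme.Opens.ι_preimage_compl_closure_image_compl V W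
  have hRegWc : Scheme.regularLocus X ⊆ (Wc : Set X) :=
    regularLocus_subset_compl_closure_image_compl V W hReg hW
  -- glue
  obtain ⟨N, ρ, hN, hρ, hbir, h6, h7⟩ := exists_glue_of_openGluing hOG V Wc π hY W hWne hWc
  refine ⟨V ⊔ Wc, N, ρ, hN, hρ, hbir, ?_, le_sup_left, ?_, h7⟩
  · intro x hx
    exact Opens.mem_sup.mpr (Or.inr (hRegWc hx))
  · intro n hn
    exact h6 n (hRegWc ((Scheme.mem_regularLocus _).mpr hn)) hn

namespace ProperModel

/-- **`OpenGluing` + SAND⁺(p) ⇒ local RegLe-ification in characteristic `p`** (Zariski 1944;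
Piltant 2013, proof of Prop. 5.1, Steps 4–5, one-morphism form for proper models): for a morphism
`φ : M → Y` of proper models of `K/k`, `char k = p`, let `U := Reg Y` (open, Matsumura 30.5,
`isOpen_regularLocus_of_locallyOfFiniteType_field`; it contains the generic point) and
`V := φ⁻¹(U)` (a non-empty open of `M`). Then `V → U` is proper and birational
(`ProperModel.Hom.isBirational`, restricted to `U`) over the regular integral separated
`k`-scheme of finite type `U`, so `SandwichedStrongResolution p` gives a resolution
`π : Yv → V` which is an isomorphism over `Reg V`; `exists_localRegLeification_data` glues it to
`M ∖ closure (Sing V)`, producing the open `O ⊇ Reg M ∪ φ⁻¹(Reg Y)` and the proper birational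
integral `N → O` regular over both loci. [cite: Piltant2013, proof of Prop. 5.1, Steps 4-5] -/
theorem localRegLeification_of_sandwiched (p : ℕ) (hOG : OpenGluing.{u})
    (hS : SandwichedStrongResolution.{u} p) : ProperModel.LocalRegLeification.{u} p := by
  intro k _ _ K _ _ _ M Y φ
  -- the open `U = Reg Y` and the generic points
  let U : Y.X.Opens :=
    ⟨Scheme.regularLocus Y.X, isOpen_regularLocus_of_locallyOfFiniteType_field Y.π⟩
  have hgenY : genericPoint Y.X ∈ U := by
    show genericPoint Y.X ∈ Scheme.regularLocus Y.X
    apply Scheme.genericPoints_subset_regularLocus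
    rw [genericPoints_eq_singleton]
    rfl
  have hφgen : φ.f (genericPoint M.X) = genericPoint Y.X := by
    rw [← M.genericPt_eq, ← Scheme.Hom.comp_apply, φ.gen_f]
    exact Y.genericPt_eq
  have hgenM : genericPoint M.X ∈ φ.f ⁻¹ᵁ U := by
    show φ.f (genericPoint M.X) ∈ U
    rw [hφgen]
    exact hgenY
  haveI : Nonempty (U : Scheme.{u}) := ⟨⟨_, hgenY⟩⟩
  haveI : Nonempty (↑(φ.f ⁻¹ᵁ U) : Scheme.{u}) := ⟨⟨_, hgenM⟩⟩
  haveI : IsIntegral (U : Scheme.{u}) := isIntegral_of_isOpenImmersion U.ι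
  haveI : IsIntegral (↑(φ.f ⁻¹ᵁ U) : Scheme.{u}) :=
    isIntegral_of_isOpenImmersion (φ.f ⁻¹ᵁ U).ι
  have hUreg : Scheme.IsRegular (U : Scheme.{u}) := fun u =>
    (isRegularLocalRing_stalk_iff_of_isOpenImmersion U.ι u).mp u.2
  -- SAND⁺ for the sandwiched piece `φ⁻¹(U) → U` over `U → Spec k`
  obtain ⟨Yv, π, hres, W, hW, hπW⟩ := hS k (U : Scheme.{u}) (↑(φ.f ⁻¹ᵁ U)) (U.ι ≫ Y.π)
    (φ.f ∣_ U) inferInstance inferInstance inferInstance inferInstance hUreg inferInstance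
    inferInstance (φ.isBirational.morphismRestrict U)
  haveI := hres.isProper
  haveI := hπW
  haveI : IsIntegral Yv := by
    haveI := hres.isRegular.isReduced
    exact hres.isBirational.isIntegral
  -- glue
  obtain ⟨O, N, ρ, hN, hρ, hbir, hRegO, hVO, h6, h7⟩ :=
    exists_localRegLeification_data hOG (isOpen_regularLocus_of_locallyOfFiniteType_field M.π)
      (φ.f ⁻¹ᵁ U) π hres.isRegular W hW
  refine ⟨O, N, ρ, hN, hρ, hbir, fun m hm => hRegO hm, fun m hm => hVO ?_, h6, fun n hn => h7 n hn⟩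
  exact hm

end ProperModel

end Literature.AlgebraicGeometry.Resolution

end
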